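import Literature.NumberTheory.Transcendental.KirbyDerivationExtension
import Literature.NumberTheory.Transcendental.RosenlichtDifferentials
import Literature.NumberTheory.Transcendental.WeakCITLattice
import Literature.NumberTheory.Transcendental.GammaLocusSlices
import HarnessLib

/-!
# Bays–Kirby 2018, Prop. 11.5 without Thm 11.4 — step 2: the Schanuel bound with the maximal lattice

Support file for the direct proof of `Literature.NumberTheory.Transcendental.BaysKirby2018_prop_11_5`
(Bays–Kirby 2018, Prop. 11.5). This is the one-differential-field half of Zilber's
"Ax + compactness" argument (Zilber 2002, Thm 2 ⟹ Cor. 3; Kirby 2009, Thm 4.3 "uniform Schanuel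
property", proof of Thm 4.6), in the quantitative form the direct route needs: not merely *some*
integer relation among the logarithms modulo constants (as in `WeakCITSchanuel.lean`), but the
*maximal* lattice `Λ*` of such relations together with Ax's inequality for the quotient by it.

**Setting** (`exists_limit_matrix`). `L` is a field of characteristic zero with derivations `D_c`
(`c ∈ Fin N ⊕ Fin N`), constants `C`; `x ∈ Lᴺ` are logarithms of the unit coordinates of a point
`ζ ∈ L^{N ⊕ N}` (`D ζ₂ᵢ = ζ₂ᵢ D xᵢ`); the Jacobian of the "logarithmic coordinates"
`(ζ₁, x)` is the identity on a set `S` of indices; and `x = U₁' x''` for a matrix `U₁'` with constant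
entries and `x''ⱼ` constant for `j ∈ J₁` (the relations inherited from the level, in unimodular
form). Let `Λ* = {m ∈ ℤᴺ | Σ mₗ xₗ ∈ C}` (a pure lattice). **Conclusion**: there is an integer matrix
`M_H` whose rows generate `Λ*` (`closure (rows M_H) = Λ*`, stated; so every element of the saturated
row lattice `rowSat M_H` is an integer combination of rows, and is a relation) with
`|S| + (N - rk M_H) ≤ rk_alg(ζ / C) + (N - |J₁|)`, the relative rank being taken in the algebraic
matroid of `L/ℚ` (`GammaField.algMatroid`), i.e. `td(ζ/C)`.

**Proof.** Smith normal form (`WeakCIT.exists_unimodular`) gives unimodular coordinates adapted to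
`Λ*`; the new logarithms off `J*` are `ℚ`-linearly independent modulo `C` by maximality, so Ax's
theorem (`Ax1971.add_rank_le_trdeg_of_field`) bounds `td(x', y'/C)` below by
`(N - rk) + rank (D x')`; the additive coordinates contribute `rank` of their `D`-rows modulo those
of `x'` (Rosenlicht 1976, Prop. 3: `Rosenlicht.finrank_span_le_trdeg_adjoin` for the derivation
"`D`-row modulo the span of the rows of `x'`"), and the two add up along the tower
`C ⊆ C(x', y') ⊆ C(ζ, x)` (`Matroid.relRank_add_relRank'`) to `|S| + (N - rk) ≤ td(ζ, x / C)`;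
finally `td(ζ, x/C) ≤ td(ζ/C) + (N - |J₁|)` since `x ∈ C(x'')` and `x''ⱼ ∈ C` for `j ∈ J₁`.

The constants are the tree's `constantSubring D` (`AxSchanuel.lean`; a field,
`isField_constantSubring`), through which Ax's theorem is invoked in the form
`Ax1971.add_rank_le_trdeg` (`AxSchanuelUniv.lean`); inside the proof the same set is also read as
the subfield `Rosenlicht.derivationPreimage (rowDer D) ⊥` (`constantSubring_eq_derivationPreimage`),
which is what `IntermediateField.adjoin` and the matroid bridge
`ZilberGSGC.toENat_trdeg_adjoin_subfield_eq_relRank` want. (`WeakCIT.constField` /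
`WeakCIT.constDerivation` of `WeakCITSchanuel.lean` are the `ℂ`-algebra specialisation of
`constantSubring` / `toConstDerivation`, to be retired in their favour by a librarian pass.)

## References

* M. Bays, J. Kirby, *Pseudo-exponential maps, variants, and quasiminimality*, ANT 12 (2018),
  Prop. 11.5.
* J. Ax, *On Schanuel's conjectures*, Ann. of Math. 93 (1971), Thm 3.
* J. Kirby, *The theory of the exponential differential equations of semiabelian varieties*,
  Selecta Math. 15 (2009), Thm 4.3, Thm 4.6 (proof).
* B. Zilber, *Exponential sums equations and the Schanuel conjecture*, J. LMS 65 (2002), Thm 2,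
  Cor. 3.
-/

noncomputable section

open MvPolynomial Set Cardinal

universe u

namespace Literature.NumberTheory.Transcendental.Prop115

open GammaField

variable {L : Type u} [Field L] [CharZero L] {τ : Type} (D : τ → Derivation ℤ L L)

/-! ### The `D`-row of an element, constants -/

/-- The `D`-row `c ↦ D_c z` of an element, as a derivation of `L` into `L^τ` (over `ℚ`: derivations
of a field of characteristic zero are `ℚ`-linear, `derivation_map_rat_smul`). [folklore] -/
def rowDer : Derivation ℚ L (τ → L) where
  toFun z := fun j => D j z
  map_add' a b := funext fun j => map_add (D j) a b
  map_smul' r a := funext fun j => by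
    show D j (r • a) = (r • fun j => D j a) j
    rw [derivation_map_rat_smul]; rfl
  map_one_eq_zero' := funext fun j => (D j).map_one_eq_zero
  leibniz' a b := funext fun j => by
    show D j (a * b) = (a • (fun j => D j b) + b • fun j => D j a) j
    rw [Derivation.leibniz]; rfl

/-- Unfolding `rowDer`. [folklore] -/
@[simp] theorem rowDer_apply (z : L) (j : τ) : rowDer D z j = D j z := rfl

/-- **The constants as a subfield**: the tree's `constantSubring D` (`AxSchanuel.lean`) has the same
elements as the subfield `Rosenlicht.derivationPreimage (rowDer D) ⊥` of elements with vanishing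
`D`-row. [folklore] -/
theorem coe_constantSubring_eq_derivationPreimage :
    (constantSubring D : Set L) = (Rosenlicht.derivationPreimage (rowDer D) ⊥ : Set L) := by
  ext a
  rw [SetLike.mem_coe, mem_constantSubring, SetLike.mem_coe, Rosenlicht.mem_derivationPreimage,
    Submodule.mem_bot]
  exact ⟨fun h => funext h, fun h j => congrFun h j⟩

/-- Membership in `Rosenlicht.derivationPreimage (rowDer D) ⊥`: the `D`-row vanishes. [folklore] -/
theorem mem_derivationPreimage_rowDer_iff {a : L} :
    a ∈ Rosenlicht.derivationPreimage (rowDer D) ⊥ ↔ ∀ j, D j a = 0 := by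
  rw [Rosenlicht.mem_derivationPreimage, Submodule.mem_bot]
  exact ⟨fun h j => congrFun h j, fun h => funext h⟩

/-! ### Transcendence degree of `R[T]` along a change of base presentation -/

section Transport

/-- `trdeg` along a base isomorphism and an injective compatible ring map (every algebraically
independent family is carried to one, `AlgebraicIndependent.ringHom_of_comp_eq`; cf.
`GammaField.lift_trdeg_le_of_ringEquiv_of_comp_eq`; one universe). [folklore] -/
theorem trdeg_le_of_ringEquiv_of_comp_eq {R S A B : Type u} [CommRing R] [CommRing S] [Nontrivial S]
    [CommRing A] [CommRing B] [Algebra R A] [Algebra S B] (f : R ≃+* S) (g : A →+* B)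
    (hg : Function.Injective g) (h : (algebraMap S B).comp f.toRingHom = g.comp (algebraMap R A)) :
    Algebra.trdeg R A ≤ Algebra.trdeg S B := by
  rw [Algebra.trdeg]
  refine ciSup_le' fun s => ?_
  have hs : AlgebraicIndependent R ((↑) : s.1 → A) := s.2
  have : AlgebraicIndependent S (g ∘ ((↑) : s.1 → A)) :=
    hs.ringHom_of_comp_eq f g f.surjective hg h
  exact this.cardinalMk_le_trdeg

/-- **`trdeg_R R[T] = trdeg_S S[T]`** for two base rings `R ≃ S` mapping compatibly into the same
field `E` (the subrings `R[T]` and `S[T]` of `E` coincide; one universe). [folklore] -/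
theorem trdeg_adjoin_eq_of_ringEquiv {R S E : Type u} [CommRing R] [CommRing S] [Nontrivial R]
    [Nontrivial S] [Field E] [Algebra R E] [Algebra S E] (θ : R ≃+* S)
    (hθ : ∀ x, algebraMap S E (θ x) = algebraMap R E x) (T : Set E) :
    Algebra.trdeg R (Algebra.adjoin R T) = Algebra.trdeg S (Algebra.adjoin S T) := by
  have hrange : Set.range (algebraMap S E) = Set.range (algebraMap R E) := by
    ext w
    constructor
    · rintro ⟨y, rfl⟩
      obtain ⟨x, rfl⟩ := θ.surjective y
      exact ⟨x, (hθ x).symm⟩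
    · rintro ⟨x, rfl⟩
      exact ⟨θ x, hθ x⟩
  have hcarrier : ∀ z : E, z ∈ Algebra.adjoin R T ↔ z ∈ Algebra.adjoin S T := by
    intro z
    rw [Algebra.mem_adjoin_iff, Algebra.mem_adjoin_iff, hrange]
  let g : Algebra.adjoin R T →+* Algebra.adjoin S T :=
    (Algebra.adjoin R T).val.toRingHom.codRestrict (Algebra.adjoin S T) fun a => (hcarrier a).1 a.2
  let g' : Algebra.adjoin S T →+* Algebra.adjoin R T :=
    (Algebra.adjoin S T).val.toRingHom.codRestrict (Algebra.adjoin R T) fun a => (hcarrier a).2 a.2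
  have hgval : ∀ a, ((g a : Algebra.adjoin S T) : E) = a := fun a => by
    show ((RingHom.codRestrict _ _ _ a : Algebra.adjoin S T) : E) = a
    rw [RingHom.codRestrict_apply, AlgHom.toRingHom_eq_coe, AlgHom.coe_toRingHom, Subalgebra.coe_val]
  have hg'val : ∀ a, ((g' a : Algebra.adjoin R T) : E) = a := fun a => by
    show ((RingHom.codRestrict _ _ _ a : Algebra.adjoin R T) : E) = a
    rw [RingHom.codRestrict_apply, AlgHom.toRingHom_eq_coe, AlgHom.coe_toRingHom, Subalgebra.coe_val]
  have hg : Function.Injective g := fun a b hab => by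
    apply Subtype.ext
    rw [← hgval a, ← hgval b, hab]
  have hg' : Function.Injective g' := fun a b hab => by
    apply Subtype.ext
    rw [← hg'val a, ← hg'val b, hab]
  have hcomp : (algebraMap S (Algebra.adjoin S T)).comp θ.toRingHom =
      g.comp (algebraMap R (Algebra.adjoin R T)) := by
    refine RingHom.ext fun x => Subtype.ext ?_
    rw [RingHom.comp_apply, RingHom.comp_apply, hgval, Subalgebra.coe_algebraMap,
      Subalgebra.coe_algebraMap]
    exact hθ x
  have hcomp' : (algebraMap R (Algebra.adjoin R T)).comp θ.symm.toRingHom =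
      g'.comp (algebraMap S (Algebra.adjoin S T)) := by
    refine RingHom.ext fun y => Subtype.ext ?_
    obtain ⟨x, rfl⟩ := θ.surjective y
    rw [RingHom.comp_apply, RingHom.comp_apply, hg'val, Subalgebra.coe_algebraMap,
      Subalgebra.coe_algebraMap, RingEquiv.toRingHom_eq_coe, RingEquiv.coe_toRingHom,
      θ.symm_apply_apply, hθ]
  exact le_antisymm (trdeg_le_of_ringEquiv_of_comp_eq θ g hg hcomp)
    (trdeg_le_of_ringEquiv_of_comp_eq θ.symm g' hg' hcomp')

end Transport

variable {N : ℕ}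

/-- The additive map `m ↦ (D_c (Σₗ mₗ xₗ))_c` on `ℤᴺ`. [folklore] -/
def relMap (x : Fin N → L) : (Fin N → ℤ) →+ (τ → L) where
  toFun m := rowDer D (∑ l, (m l : L) * x l)
  map_zero' := by simp
  map_add' m m' := by
    have : (∑ l, ((m + m') l : L) * x l) = (∑ l, (m l : L) * x l) + ∑ l, (m' l : L) * x l := by
      simp only [Pi.add_apply, Int.cast_add, add_mul, Finset.sum_add_distrib]
    rw [this, map_add]

/-- The **relation lattice** `Λ* = {m ∈ ℤᴺ | Σ mₗ xₗ is a constant}` of the logarithms `x`.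
[cite: Kirby2009, Thm 4.3 (proof)] -/
def relLattice (x : Fin N → L) : AddSubgroup (Fin N → ℤ) := (relMap D x).ker

/-- Membership in the relation lattice. [folklore] -/
theorem mem_relLattice_iff {x : Fin N → L} {m : Fin N → ℤ} :
    m ∈ relLattice D x ↔ ∀ j, D j (∑ l, (m l : L) * x l) = 0 := by
  rw [relLattice, AddMonoidHom.mem_ker]
  constructor
  · intro h j; exact congrFun h j
  · intro h; exact funext h

/-- The relation lattice is pure (saturated): `L^τ` is torsion-free. [folklore] -/
theorem nsmulSaturated_relLattice (x : Fin N → L) :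
    (relLattice D x).toAddSubmonoid.NSMulSaturated := by
  intro n m hm
  by_cases hn : n = 0
  · exact Or.inl hn
  · right
    rw [AddSubgroup.mem_toAddSubmonoid, mem_relLattice_iff] at hm ⊢
    intro j
    have h := hm j
    have : (∑ l, ((n • m) l : L) * x l) = (n : L) * ∑ l, (m l : L) * x l := by
      rw [Finset.mul_sum]
      refine Finset.sum_congr rfl fun l _ => ?_
      simp [mul_assoc]
    rw [this, Derivation.leibniz, Derivation.map_natCast, smul_zero, add_zero, smul_eq_mul] at h
    exact (mul_eq_zero.1 h).resolve_left (Nat.cast_ne_zero.2 hn)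

/-! ### Laurent monomials along an exponential pair -/

omit [CharZero L] in
/-- If `D yᵢ = yᵢ D xᵢ` (`yᵢ ≠ 0`) then `D (∏ yᵢ^{wᵢ}) = (∏ yᵢ^{wᵢ}) · D (Σ wᵢ xᵢ)`. [folklore] -/
theorem derivation_prod_zpow {R : Type*} [CommRing R] [Algebra R L] (δ : Derivation R L L)
    (x y : Fin N → L) (hy : ∀ i, y i ≠ 0) (hD : ∀ i, δ (y i) = y i * δ (x i)) (w : Fin N → ℤ) :
    δ (∏ i, y i ^ w i) = (∏ i, y i ^ w i) * δ (∑ i, (w i : L) * x i) := by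
  have hP : (∏ i, y i ^ w i) ≠ 0 := Finset.prod_ne_zero_iff.mpr fun i _ => zpow_ne_zero _ (hy i)
  have h := inv_mul_derivation_prod_zpow δ Finset.univ y (fun i _ => hy i) w
  rw [inv_mul_eq_iff_eq_mul₀ hP] at h
  rw [h]
  congr 1
  rw [map_sum]
  refine Finset.sum_congr rfl fun i _ => ?_
  rw [Derivation.leibniz, δ.map_intCast, smul_zero, add_zero, smul_eq_mul, hD i,
    inv_mul_cancel_left₀ (hy i)]

/-! ### The matrix of a pure lattice in unimodular coordinates -/

/-- The matrix whose rows are the rows `Uⱼ`, `j ∈ J`, of `U` and `0` elsewhere. [folklore] -/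
def latMatrix (U : Matrix (Fin N) (Fin N) ℤ) (J : Finset (Fin N)) : Matrix (Fin N) (Fin N) ℤ :=
  Matrix.of fun i l => if i ∈ J then U i l else 0

/-- Rows of `latMatrix` in `J`. [folklore] -/
theorem latMatrix_row_of_mem {U : Matrix (Fin N) (Fin N) ℤ} {J : Finset (Fin N)} {i : Fin N}
    (hi : i ∈ J) : latMatrix U J i = U i := by
  funext l; simp [latMatrix, hi]

/-- Rows of `latMatrix` off `J` vanish. [folklore] -/
theorem latMatrix_row_of_not_mem {U : Matrix (Fin N) (Fin N) ℤ} {J : Finset (Fin N)} {i : Fin N}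
    (hi : i ∉ J) : latMatrix U J i = 0 := by
  funext l; simp [latMatrix, hi]

/-- The rows of `latMatrix U J` generate the same subgroup as the rows `Uⱼ`, `j ∈ J`. [folklore] -/
theorem closure_range_latMatrix (U : Matrix (Fin N) (Fin N) ℤ) (J : Finset (Fin N)) :
    AddSubgroup.closure (Set.range (latMatrix U J)) =
      AddSubgroup.closure ((fun j => U j) '' (J : Set (Fin N))) := by
  apply le_antisymm
  · rw [AddSubgroup.closure_le]
    rintro _ ⟨i, rfl⟩
    by_cases hi : i ∈ J
    · rw [SetLike.mem_coe, latMatrix_row_of_mem hi]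
      exact AddSubgroup.subset_closure ⟨i, hi, rfl⟩
    · rw [SetLike.mem_coe, latMatrix_row_of_not_mem hi]
      exact AddSubgroup.zero_mem _
  · rw [AddSubgroup.closure_le]
    rintro _ ⟨i, hi, rfl⟩
    refine AddSubgroup.subset_closure ⟨i, ?_⟩
    exact latMatrix_row_of_mem (by exact_mod_cast hi)

/-- The saturated row lattice of `latMatrix U J` lies in any pure subgroup generated by the rows
`Uⱼ`, `j ∈ J`, and consists of integer combinations of the rows. [folklore] -/
theorem rowSat_latMatrix_subset {U : Matrix (Fin N) (Fin N) ℤ} {J : Finset (Fin N)}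
    {Λ : AddSubgroup (Fin N → ℤ)} (hΛ : Λ.toAddSubmonoid.NSMulSaturated)
    (hΛeq : Λ = AddSubgroup.closure ((fun j => U j) '' (J : Set (Fin N)))) {m : Fin N → ℤ}
    (hm : m ∈ rowSat N (latMatrix U J)) :
    m ∈ Λ ∧ m ∈ AddSubgroup.closure (Set.range (latMatrix U J)) := by
  obtain ⟨d, hd0, hdm⟩ := hm
  have hspan : ∀ v : Fin N → ℤ, v ∈ Submodule.span ℤ (Set.range (latMatrix U J)) ↔
      v ∈ AddSubgroup.closure (Set.range (latMatrix U J)) := fun v => by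
    rw [← Submodule.span_int_eq_addSubgroupClosure, Submodule.mem_toAddSubgroup]
  have hdm' : d • m ∈ Λ := by
    rw [hΛeq, ← closure_range_latMatrix, ← hspan]
    exact hdm
  have hmΛ : m ∈ Λ := by
    -- purity: `d • m ∈ Λ`, `d ≠ 0` gives `m ∈ Λ` (through `|d| • m`)
    have h1 : d.natAbs • m ∈ Λ := by
      rcases Int.natAbs_eq d with h | h
      · have : (d.natAbs : ℤ) • m = d • m := by rw [← h]
        rw [← natCast_zsmul, this]; exact hdm'
      · have : (d.natAbs : ℤ) • m = -(d • m) := by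
          conv_rhs => rw [h]
          rw [neg_zsmul, neg_neg]
        rw [← natCast_zsmul, this]; exact Λ.neg_mem hdm'
    rcases hΛ h1 with h0 | h
    · exact absurd (Int.natAbs_eq_zero.1 h0) hd0
    · exact h
  refine ⟨hmΛ, ?_⟩
  rw [closure_range_latMatrix, ← hΛeq]
  exact hmΛ

/-- The rank (over `ℚ`) of `latMatrix U J` is `|J|` when `U` is invertible over `ℤ`. [folklore] -/
theorem rank_latMatrix {U U' : Matrix (Fin N) (Fin N) ℤ} (hUU' : U * U' = 1) (J : Finset (Fin N)) :
    ((latMatrix U J).map (Int.cast : ℤ → ℚ)).rank = J.card := by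
  classical
  set Uq : Matrix (Fin N) (Fin N) ℚ := U.map (Int.cast : ℤ → ℚ) with hUq
  have hUUq : Uq * U'.map (Int.cast : ℤ → ℚ) = 1 := by
    have h := congrArg (fun M : Matrix (Fin N) (Fin N) ℤ => M.map (Int.castRingHom ℚ)) hUU'
    simp only [Matrix.map_mul] at h
    rw [Matrix.map_one _ (map_zero _) (map_one _)] at h
    rw [hUq]
    exact h
  -- the rows of `Uq` are linearly independent
  have hli : LinearIndependent ℚ Uq.row :=
    Matrix.linearIndependent_rows_iff_isUnit.2
      ((Matrix.isUnit_iff_isUnit_det _).2 (Matrix.isUnit_det_of_right_inverse hUUq))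
  rw [Matrix.rank_eq_finrank_span_row]
  have hrow_mem : ∀ i ∈ J, ((latMatrix U J).map (Int.cast : ℤ → ℚ)).row i = Uq.row i := by
    intro i hi
    funext l
    simp [Matrix.row, latMatrix, hi, hUq]
  have hrow_not : ∀ i ∉ J, ((latMatrix U J).map (Int.cast : ℤ → ℚ)).row i = 0 := by
    intro i hi
    funext l
    simp [Matrix.row, latMatrix, hi]
  have heq : Submodule.span ℚ (Set.range ((latMatrix U J).map (Int.cast : ℤ → ℚ)).row) =
      Submodule.span ℚ (Set.range fun i : (J : Set (Fin N)) => Uq.row i) := by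
    apply le_antisymm
    · rw [Submodule.span_le]
      rintro _ ⟨i, rfl⟩
      by_cases hi : i ∈ J
      · rw [hrow_mem i hi]
        exact Submodule.subset_span ⟨⟨i, hi⟩, rfl⟩
      · rw [hrow_not i hi]
        exact Submodule.zero_mem _
    · rw [Submodule.span_le]
      rintro _ ⟨⟨i, hi⟩, rfl⟩
      show Uq.row i ∈ _
      rw [← hrow_mem i hi]
      exact Submodule.subset_span ⟨i, rfl⟩
  have hli' : LinearIndependent ℚ (fun i : (J : Set (Fin N)) => Uq.row i) :=
    hli.comp _ Subtype.val_injective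
  rw [heq, finrank_span_eq_card hli']
  simp

/-! ### Linear algebra of `D`-rows -/

section Rows

/-- Unit `D`-rows are linearly independent: if the rows of the elements `w b`, `b ∈ S`, are the
unit vectors `e_b`, the span of any set of rows containing them has dimension `≥ |S|`.
[folklore] -/
theorem card_le_finrank_span_of_unit_rows [Fintype τ] [DecidableEq τ] (S : Finset τ) (w : τ → L)
    (hS : ∀ b ∈ S, ∀ j, D j (w b) = if b = j then 1 else 0) (T : Set L) (hT : ∀ b ∈ S, w b ∈ T) :
    S.card ≤ Module.finrank L (Submodule.span L (rowDer D '' T)) := by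
  have hrow : ∀ b ∈ S, rowDer D (w b) = Pi.single b (1 : L) := by
    intro b hb
    funext j
    rw [rowDer_apply, hS b hb j, Pi.single_apply]
    simp only [eq_comm]
  have hli : LinearIndependent L (fun b : S => (Pi.single (b : τ) (1 : L) : τ → L)) := by
    have h2 : (fun b : S => (Pi.single (b : τ) (1 : L) : τ → L)) =
        (Pi.basisFun L τ) ∘ ((↑) : S → τ) := by
      funext b; simp [Pi.basisFun_apply]
    rw [h2]
    exact (Pi.basisFun L τ).linearIndependent.comp _ Subtype.val_injective
  have hsub : Set.range (fun b : S => (Pi.single (b : τ) (1 : L) : τ → L)) ⊆ rowDer D '' T := by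
    rintro _ ⟨b, rfl⟩
    exact ⟨w b, hT b b.2, hrow b b.2⟩
  calc S.card = Fintype.card S := (Fintype.card_coe S).symm
    _ = Module.finrank L (Submodule.span L
          (Set.range (fun b : S => (Pi.single (b : τ) (1 : L) : τ → L)))) :=
        (finrank_span_eq_card hli).symm
    _ ≤ Module.finrank L (Submodule.span L (rowDer D '' T)) :=
        Submodule.finrank_mono (Submodule.span_mono hsub)

omit [CharZero L] in
/-- Passing to a quotient loses at most the dimension of the kernel:
`finrank V ≤ finrank (V mod V₀) + finrank V₀`. [folklore] -/
theorem finrank_le_finrank_map_mkQ_add {M : Type*} [AddCommGroup M] [Module L M]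
    [FiniteDimensional L M] (V V₀ : Submodule L M) :
    Module.finrank L V ≤ Module.finrank L (V.map V₀.mkQ) + Module.finrank L V₀ := by
  set f : V →ₗ[L] M ⧸ V₀ := V₀.mkQ.comp V.subtype with hf
  have h1 := LinearMap.finrank_range_add_finrank_ker f
  have hrange : LinearMap.range f = V.map V₀.mkQ := by
    rw [hf, LinearMap.range_comp, Submodule.range_subtype]
  have hker : Module.finrank L (LinearMap.ker f) ≤ Module.finrank L V₀ := by
    let g : LinearMap.ker f →ₗ[L] V₀ :=
      LinearMap.codRestrict V₀ (V.subtype.comp (LinearMap.ker f).subtype) (fun z => by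
        have hz : f z = 0 := LinearMap.mem_ker.1 z.2
        change V₀.mkQ (V.subtype z) = 0 at hz
        exact (Submodule.Quotient.mk_eq_zero V₀).1 hz)
    refine LinearMap.finrank_le_finrank_of_injective (f := g) fun a b hab => ?_
    have := congrArg (fun z : V₀ => (z : M)) hab
    exact Subtype.ext (Subtype.ext this)
  rw [hrange] at h1
  omega

/-- The rank of the matrix `(D_{e⁻¹ j} (v i))ᵢⱼ` (derivations reindexed by `Fin`) is the dimension of
the span of the `D`-rows of the `v i`. [folklore] -/
theorem rank_reindex_eq_finrank_span [Fintype τ] {h : ℕ} (e : τ ≃ Fin (Fintype.card τ))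
    (v : Fin h → L) {R : Type*} [CommSemiring R] [Algebra R L] (Dk : τ → Derivation R L L)
    (hDk : ∀ j z, Dk j z = D j z) :
    (Matrix.of fun i j => Dk (e.symm j) (v i)).rank =
      Module.finrank L (Submodule.span L (Set.range fun i => rowDer D (v i))) := by
  classical
  rw [Matrix.rank_eq_finrank_span_row]
  set Φ : (τ → L) ≃ₗ[L] (Fin (Fintype.card τ) → L) := LinearEquiv.funCongrLeft L L e.symm with hΦ
  have hrow : ∀ i, (Matrix.of fun i j => Dk (e.symm j) (v i)).row i =
      (Φ : (τ → L) →ₗ[L] (Fin (Fintype.card τ) → L)) (rowDer D (v i)) := by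
    intro i
    funext j
    simp [hΦ, Matrix.row, LinearEquiv.funCongrLeft_apply, LinearMap.funLeft_apply, hDk]
  have : Set.range (Matrix.of fun i j => Dk (e.symm j) (v i)).row =
      (Φ : (τ → L) →ₗ[L] (Fin (Fintype.card τ) → L)) '' Set.range (fun i => rowDer D (v i)) := by
    ext w
    simp only [Set.mem_range, Set.mem_image, exists_exists_eq_and, hrow]
  rw [this, Submodule.span_image, LinearEquiv.finrank_map_eq]

end Rows

/-! ### The main bound -/

section Main

variable {D}

/-- **The Schanuel bound with the maximal relation lattice** (Ax's theorem in unimodular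
coordinates adapted to `Λ*`, plus the additive rows, along the tower `C ⊆ C(x', y') ⊆ C(ζ, x)`).
See the module docstring. [cite: BaysKirby2018ANT, Prop. 11.5]
[cite: Kirby2009, Thm 4.3 and Thm 4.6 (proof)] -/
theorem exists_limit_matrix {N : ℕ} {D : Fin N ⊕ Fin N → Derivation ℤ L L}
    (x : Fin N → L) (ζ : Fin N ⊕ Fin N → L) (hζ : ∀ i, ζ (Sum.inr i) ≠ 0)
    (hexp : ∀ j i, D j (ζ (Sum.inr i)) = ζ (Sum.inr i) * D j (x i))
    (U₁' : Matrix (Fin N) (Fin N) L) (hU₁' : ∀ j i l, D j (U₁' i l) = 0)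
    (xpp : Fin N → L) (hx : ∀ i, x i = ∑ l, U₁' i l * xpp l)
    (J₁ : Finset (Fin N)) (hJ₁ : ∀ i ∈ J₁, ∀ j, D j (xpp i) = 0)
    (S : Finset (Fin N ⊕ Fin N))
    (hS : ∀ b ∈ S, ∀ j, D j (Sum.elim (fun i => ζ (Sum.inl i)) x b) = if b = j then 1 else 0) :
    ∃ MH : Matrix (Fin N) (Fin N) ℤ,
      AddSubgroup.closure (Set.range MH) = relLattice D x ∧
      (∀ m ∈ rowSat N MH, m ∈ AddSubgroup.closure (Set.range MH) ∧
        ∀ j, D j (∑ l, (m l : L) * x l) = 0) ∧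
      ((S.card + (N - (MH.map (Int.cast : ℤ → ℚ)).rank) : ℕ) : ℕ∞) ≤
        (algMatroid L).relRank (constantSubring D : Set L) (Set.range ζ) + ((N - J₁.card : ℕ) : ℕ∞) := by
  classical
  -- constants (read as a subfield), the lattice and unimodular coordinates adapted to it
  rw [coe_constantSubring_eq_derivationPreimage]
  set C : Subfield L := Rosenlicht.derivationPreimage (rowDer D) ⊥ with hCdef
  have hmemC : ∀ a, a ∈ C ↔ ∀ j, D j a = 0 := fun a => mem_derivationPreimage_rowDer_iff D
  set Λ : AddSubgroup (Fin N → ℤ) := relLattice D x with hΛdef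
  obtain ⟨U, U', J, hUU', hU'U, hUJ, hΛeq⟩ :=
    WeakCIT.exists_unimodular Λ (nsmulSaturated_relLattice D x)
  refine ⟨latMatrix U J, ?_, fun m hm => ?_, ?_⟩
  · rw [closure_range_latMatrix, ← hΛeq]
  · obtain ⟨hmΛ, hmcl⟩ := rowSat_latMatrix_subset (nsmulSaturated_relLattice D x) hΛeq hm
    exact ⟨hmcl, (mem_relLattice_iff D).1 hmΛ⟩
  rw [rank_latMatrix hUU']
  -- notation
  set Mat := algMatroid L with hMat
  set G₂ : Set L := Set.range ζ ∪ Set.range x with hG₂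
  set h : ℕ := (Jᶜ : Finset (Fin N)).card with hh
  have hhN : h = N - J.card := by rw [hh, Finset.card_compl, Fintype.card_fin]
  /- (A) the lower bound `h + |S| ≤ rk(ζ, x / C)` -/
  have hA : ((h + S.card : ℕ) : ℕ∞) ≤ Mat.relRank (C : Set L) G₂ := by
    -- the derivations reindexed by `Fin` (for Ax's theorem)
    haveI : CharZero C := (algebraMap C L).charZero
    set eτ : (Fin N ⊕ Fin N) ≃ Fin (Fintype.card (Fin N ⊕ Fin N)) := Fintype.equivFin _ with heτ
    let DA : Fin (Fintype.card (Fin N ⊕ Fin N)) → Derivation ℤ L L := fun j => D (eτ.symm j)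
    have hDA : ∀ j z, DA j z = D (eτ.symm j) z := fun _ _ => rfl
    -- the new logarithms and exponentials off `J`
    set eJ : Fin h ≃ ((Jᶜ : Finset (Fin N)) : Set (Fin N)) :=
      ((Jᶜ : Finset (Fin N)).equivFin.symm.trans (Equiv.subtypeEquivRight (fun _ => Iff.rfl)))
      with heJ
    have heJmem : ∀ i, ((eJ i : Fin N)) ∉ J := fun i => by
      have := (eJ i).2
      simpa using this
    let xA : Fin h → L := fun i => ∑ l, (U (eJ i) l : L) * x l
    let yA : Fin h → L := fun i => ∏ l, ζ (Sum.inr l) ^ U (eJ i) l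
    have hyA : ∀ i, yA i ≠ 0 := fun i =>
      Finset.prod_ne_zero_iff.mpr fun l _ => zpow_ne_zero _ (hζ l)
    have hexpA : ∀ j i, DA j (yA i) = yA i * DA j (xA i) := fun j i =>
      derivation_prod_zpow (DA j) x (fun l => ζ (Sum.inr l)) hζ (fun l => hexp _ l) (U (eJ i))
    -- maximality of `Λ*`: no further integer relation among the new logarithms
    have hsupp : ∀ m ∈ Λ, ∀ l ∉ J, Matrix.vecMul m U' l = 0 := by
      intro m hm
      rw [hΛeq] at hm
      refine AddSubgroup.closure_induction (fun v hv => ?_) (fun l _ => by simp) ?_ ?_ hm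
      · obtain ⟨j, hj, rfl⟩ := hv
        intro l hl
        have hjl : (j : Fin N) ≠ l := fun h => hl (h ▸ (by exact_mod_cast hj))
        have : Matrix.vecMul (U j) U' l = (U * U') j l := by
          simp [Matrix.vecMul, Matrix.mul_apply, dotProduct]
        rw [this, hUU', Matrix.one_apply, if_neg hjl]
      · intro v w _ _ hv hw l hl
        rw [Matrix.add_vecMul, Pi.add_apply, hv l hl, hw l hl, add_zero]
      · intro v _ hv l hl
        rw [Matrix.neg_vecMul, Pi.neg_apply, hv l hl, neg_zero]
    have hind : IsQLinearIndependentMod DA xA := by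
      intro q hq
      replace hq : ∀ j, DA j (∑ i, (q i : L) * xA i) = 0 := fun j => hq j
      let m : Fin N → ℤ := fun l => ∑ i, q i * U (eJ i) l
      have hsum : (∑ l, (m l : L) * x l) = ∑ i, (q i : L) * xA i := by
        simp only [m, xA, Int.cast_sum, Int.cast_mul, Finset.sum_mul, Finset.mul_sum]
        rw [Finset.sum_comm]
        refine Finset.sum_congr rfl fun i _ => Finset.sum_congr rfl fun l _ => ?_
        ring
      have hm : m ∈ Λ := by
        rw [hΛdef, mem_relLattice_iff]
        intro c
        have := hq (eτ c)
        rwa [hDA, Equiv.symm_apply_apply, ← hsum] at this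
      have hval : ∀ i, Matrix.vecMul m U' (eJ i) = q i := by
        intro i
        have : Matrix.vecMul m U' (eJ i) = ∑ i', q i' * (U * U') (eJ i') (eJ i) := by
          simp only [Matrix.vecMul, dotProduct, m, Matrix.mul_apply, Finset.sum_mul, Finset.mul_sum]
          rw [Finset.sum_comm]
          refine Finset.sum_congr rfl fun i' _ => Finset.sum_congr rfl fun l _ => ?_
          ring
        rw [this, hUU']
        simp only [Matrix.one_apply]
        rw [Finset.sum_eq_single i]
        · simp
        · intro i' _ hi'
          have : ((eJ i' : Fin N)) ≠ (eJ i : Fin N) := fun h =>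
            hi' (eJ.injective (Subtype.ext h))
          simp [this]
        · intro h; exact absurd (Finset.mem_univ i) h
      funext i
      have := hsupp m hm (eJ i) (heJmem i)
      rw [hval] at this
      exact this
    -- Ax's theorem (over the tree's `constantSubring DA`), read over the subfield `C`
    have hAx := Ax1971.add_rank_le_trdeg DA xA yA hyA hexpA hind
    set G : Set L := Set.range xA ∪ Set.range yA with hG
    set rankA : ℕ := (Matrix.of fun i j => DA j (xA i)).rank with hrankA
    have hmemA : ∀ a : L, a ∈ constantSubring DA ↔ a ∈ C := fun a => by
      rw [mem_constantSubring, hmemC]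
      constructor
      · intro ha c; have := ha (eτ c); rwa [hDA, Equiv.symm_apply_apply] at this
      · intro ha j; rw [hDA]; exact ha _
    letI : Field (constantSubring DA) := (isField_constantSubring DA).toField
    let θ : constantSubring DA ≃+* C :=
      { toFun := fun a => ⟨a, (hmemA a).1 a.2⟩
        invFun := fun a => ⟨a, (hmemA a).2 a.2⟩
        left_inv := fun _ => rfl
        right_inv := fun _ => rfl
        map_mul' := fun _ _ => rfl
        map_add' := fun _ _ => rfl }
    have hAxC : ((h + rankA : ℕ) : Cardinal) ≤ Algebra.trdeg C (Algebra.adjoin C G) := by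
      rw [← trdeg_adjoin_eq_of_ringEquiv (E := L) θ (fun _ => rfl) G]; exact hAx
    have hAx' : ((h + rankA : ℕ) : ℕ∞) ≤ Mat.relRank (C : Set L) G := by
      have h1 := OrderHomClass.mono Cardinal.toENat hAxC
      rw [map_natCast,
        ZilberGSGC.toENat_trdeg_adjoin_subfield_eq_relRank C G] at h1
      exact h1
    -- the `D`-rows
    set V : Submodule L ((Fin N ⊕ Fin N) → L) := Submodule.span L (rowDer D '' G₂) with hV
    set V₀ : Submodule L ((Fin N ⊕ Fin N) → L) := Submodule.span L (rowDer D '' G) with hV₀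
    set Vx : Submodule L ((Fin N ⊕ Fin N) → L) :=
      Submodule.span L (Set.range fun i => rowDer D (xA i)) with hVx
    have hrank : rankA = Module.finrank L Vx :=
      rank_reindex_eq_finrank_span D eτ xA D (fun _ _ => rfl)
    have hV₀Vx : V₀ ≤ Vx := by
      rw [hV₀, Submodule.span_le]
      rintro _ ⟨g, hg, rfl⟩
      rcases hg with ⟨i, rfl⟩ | ⟨i, rfl⟩
      · exact Submodule.subset_span ⟨i, rfl⟩
      · have : rowDer D (yA i) = yA i • rowDer D (xA i) := by
          funext j
          rw [rowDer_apply, Pi.smul_apply, rowDer_apply, smul_eq_mul]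
          have h2 : D (eτ.symm (eτ j)) (yA i) = yA i * D (eτ.symm (eτ j)) (xA i) := hexpA (eτ j) i
          rwa [Equiv.symm_apply_apply] at h2
        rw [SetLike.mem_coe, this]
        exact Vx.smul_mem _ (Submodule.subset_span ⟨i, rfl⟩)
    have hSV : S.card ≤ Module.finrank L V :=
      card_le_finrank_span_of_unit_rows D S _ hS G₂ (fun b _ => by
        rcases b with i | i
        · exact Or.inl ⟨Sum.inl i, rfl⟩
        · exact Or.inr ⟨i, rfl⟩)
    -- Rosenlicht: the rows modulo `V₀`, a derivation over `E = C(G)`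
    set E : IntermediateField C L := IntermediateField.adjoin C G with hEdef
    set Esub : Subfield L := E.toSubfield with hEsub
    let δ₀ : Derivation ℚ L (((Fin N ⊕ Fin N) → L) ⧸ V₀) := (V₀.mkQ).compDer (rowDer D)
    have hδ₀ : ∀ z, δ₀ z = V₀.mkQ (rowDer D z) := fun z => rfl
    have hδ₀C : ∀ c : C, δ₀ (algebraMap C L c) = 0 := fun c => by
      rw [hδ₀]
      have : rowDer D (algebraMap C L c) = 0 := funext fun j => (hmemC _).1 c.2 j
      rw [this, map_zero]
    have hδ₀G : ∀ g ∈ G, δ₀ g = 0 := fun g hg => by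
      rw [hδ₀, Submodule.mkQ_apply, Submodule.Quotient.mk_eq_zero, hV₀]
      exact Submodule.subset_span ⟨g, hg, rfl⟩
    have hδ₀E : ∀ z : L, z ∈ E → δ₀ z = 0 := fun z hz =>
      derivation_eq_zero_on_adjoin δ₀ hδ₀C hδ₀G hz
    let δE : Derivation Esub L (((Fin N ⊕ Fin N) → L) ⧸ V₀) :=
      { toFun := δ₀
        map_add' := map_add δ₀
        map_smul' := fun e a => by
          show δ₀ ((e : L) * a) = (e : L) • δ₀ a
          rw [Derivation.leibniz, hδ₀E _ e.2, smul_zero, add_zero]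
        map_one_eq_zero' := δ₀.map_one_eq_zero
        leibniz' := δ₀.leibniz }
    have hδE : ∀ z, δE z = δ₀ z := fun _ => rfl
    have hG₂fin : G₂.Finite := (Set.finite_range ζ).union (Set.finite_range x)
    have hRos := Rosenlicht.finrank_span_le_trdeg_adjoin (k := Esub) (K := L) δE G₂ hG₂fin
    have hspanδ : Submodule.span L (δE '' G₂) = V.map V₀.mkQ := by
      have : δE '' G₂ = V₀.mkQ '' (rowDer D '' G₂) := by
        rw [Set.image_image]; rfl
      rw [this, Submodule.span_image, hV]
    have hRos' : ((Module.finrank L V - Module.finrank L V₀ : ℕ) : ℕ∞) ≤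
        Mat.relRank (Esub : Set L) G₂ := by
      have h1 := OrderHomClass.mono Cardinal.toENat hRos
      rw [map_natCast, ZilberGSGC.toENat_trdeg_adjoin_subfield_eq_relRank Esub G₂,
        hspanδ] at h1
      refine le_trans ?_ h1
      have := finrank_le_finrank_map_mkQ_add V V₀
      exact_mod_cast (show Module.finrank L V - Module.finrank L V₀ ≤
        Module.finrank L (V.map V₀.mkQ) by omega)
    -- `E` and `C ∪ G` have the same algebraic closure
    have hrangeC : Set.range (algebraMap C L) = (C : Set L) := by
      ext z
      exact ⟨fun ⟨c, hc⟩ => hc ▸ c.2, fun hz => ⟨⟨z, hz⟩, rfl⟩⟩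
    have hEset : (Esub : Set L) = (Subfield.closure ((C : Set L) ∪ G) : Set L) := by
      rw [hEsub, hEdef, IntermediateField.adjoin_toSubfield, hrangeC]
    have hEcl : Mat.relRank (Esub : Set L) G₂ = Mat.relRank ((C : Set L) ∪ G) G₂ := by
      refine Mat.relRank_congr_closure_left G₂ ?_
      show acl (Esub : Set L) = acl ((C : Set L) ∪ G)
      apply Set.Subset.antisymm
      · refine acl_subset_acl_of_subset ?_
        rw [hEset]; exact subfieldClosure_subset_acl _
      · refine acl_mono ?_
        rw [hEset]; exact Subfield.subset_closure
    -- tower `C ⊆ C ∪ G ⊆ C ∪ G ∪ G₂` and `G ⊆ acl (G₂ ∪ C)`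
    have htower : Mat.relRank (C : Set L) G + Mat.relRank ((C : Set L) ∪ G) G₂ =
        Mat.relRank (C : Set L) (G ∪ G₂) := by
      rw [← Mat.relRank_union_self_left (C : Set L) G,
        Mat.relRank_add_relRank' subset_union_left G₂, Set.union_assoc,
        Mat.relRank_union_self_left]
    have hGcl : Mat.relRank (C : Set L) (G ∪ G₂) = Mat.relRank (C : Set L) G₂ := by
      refine Mat.relRank_congr_closure (C : Set L) ?_
      show acl ((G ∪ G₂) ∪ (C : Set L)) = acl (G₂ ∪ (C : Set L))
      apply Set.Subset.antisymm
      · refine acl_subset_acl_of_subset ?_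
        rintro z ((hz | hz) | hz)
        · refine subfieldClosure_subset_acl _ ?_
          rcases hz with ⟨i, rfl⟩ | ⟨i, rfl⟩
          · refine Subfield.sum_mem _ fun l _ => Subfield.mul_mem _ (Subfield.intCast_mem _ _) ?_
            exact Subfield.subset_closure (Or.inl (Or.inr ⟨l, rfl⟩))
          · refine Subfield.prod_mem _ fun l _ => Subfield.zpow_mem _ ?_ _
            exact Subfield.subset_closure (Or.inl (Or.inl ⟨Sum.inr l, rfl⟩))
        · exact subset_acl _ (Or.inl hz)
        · exact subset_acl _ (Or.inr hz)
      · exact acl_mono (Set.union_subset_union_left _ subset_union_right)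
    -- combine
    have hfin : Module.finrank L V₀ ≤ Module.finrank L Vx := Submodule.finrank_mono hV₀Vx
    have hnat : h + S.card ≤ (h + rankA) + (Module.finrank L V - Module.finrank L V₀) := by
      rw [hrank]; omega
    calc ((h + S.card : ℕ) : ℕ∞)
        ≤ ((h + rankA : ℕ) : ℕ∞) + ((Module.finrank L V - Module.finrank L V₀ : ℕ) : ℕ∞) := by
          exact_mod_cast hnat
      _ ≤ Mat.relRank (C : Set L) G + Mat.relRank ((C : Set L) ∪ G) G₂ :=
          add_le_add hAx' (hEcl ▸ hRos')
      _ = Mat.relRank (C : Set L) G₂ := by rw [htower, hGcl]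
  /- (B) the upper bound `rk(ζ, x / C) ≤ rk(ζ / C) + (N - |J₁|)` -/
  have hB : Mat.relRank (C : Set L) G₂ ≤
      Mat.relRank (C : Set L) (Set.range ζ) + ((N - J₁.card : ℕ) : ℕ∞) := by
    have htower : Mat.relRank (C : Set L) (Set.range ζ) +
        Mat.relRank ((C : Set L) ∪ Set.range ζ) (Set.range x) = Mat.relRank (C : Set L) G₂ := by
      rw [← Mat.relRank_union_self_left (C : Set L) (Set.range ζ),
        Mat.relRank_add_relRank' subset_union_left (Set.range x), Set.union_assoc,
        Mat.relRank_union_self_left]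
    set X₂ : Set L := xpp '' (((J₁ᶜ : Finset (Fin N))) : Set (Fin N)) with hX₂
    have hxcl : Set.range x ⊆ Mat.closure (X₂ ∪ ((C : Set L) ∪ Set.range ζ)) := by
      rintro _ ⟨i, rfl⟩
      have hmem : x i ∈ Subfield.closure (X₂ ∪ ((C : Set L) ∪ Set.range ζ)) := by
        rw [hx i]
        refine Subfield.sum_mem _ fun l _ => Subfield.mul_mem _ ?_ ?_
        · exact Subfield.subset_closure (Or.inr (Or.inl ((hmemC _).2 fun j => hU₁' j i l)))
        · by_cases hl : l ∈ J₁
          · exact Subfield.subset_closure (Or.inr (Or.inl ((hmemC _).2 fun j => hJ₁ l hl j)))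
          · exact Subfield.subset_closure (Or.inl ⟨l, by simpa using hl, rfl⟩)
      exact subfieldClosure_subset_acl _ hmem
    have h1 : Mat.relRank ((C : Set L) ∪ Set.range ζ) (Set.range x) ≤
        Mat.relRank ((C : Set L) ∪ Set.range ζ) X₂ :=
      Mat.relRank_le_of_subset_closure _ hxcl
    have h2 : Mat.relRank ((C : Set L) ∪ Set.range ζ) X₂ ≤ ((N - J₁.card : ℕ) : ℕ∞) := by
      refine (Mat.relRank_le_encard_diff _ _).trans ?_
      refine (Set.encard_mono Set.sdiff_subset).trans ?_
      refine (Set.encard_image_le _ _).trans ?_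
      rw [Set.encard_coe_eq_coe_finsetCard, Finset.card_compl, Fintype.card_fin]
    rw [← htower]
    exact add_le_add le_rfl (h1.trans h2)
  -- assemble
  have hJN : J.card ≤ N := by simpa only [Fintype.card_fin] using J.card_le_univ
  have : S.card + (N - J.card) = h + S.card := by omega
  rw [this]
  exact hA.trans hB

end Main

end Literature.NumberTheory.Transcendental.Prop115
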